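import Summits.CriticalPhenomena.PercolationContinuityZ3.Theorems.Transplant.PlanarSkeletonFrmScaledDefs
import HarnessLib

/-!
# The COARSE CHART `⌊φ/N⌋` of a one-type SCALED skeleton: 1-Lipschitz when `L ≤ N`, unit steps, and chart-translating frames with at most `N²`
# HOMOGENEOUS residue types — skeleton geometry only (design-owner reduction file, RULING D-s (c) of lead g20, 2026-08-26)

builds on p205010 (kernel theorem, internal audit signed; external expert review pending) — nothing in this file uses p205010, and NOTHING is claimed about
any open node (`SamePDropOfSkeletonFrmScaled₁` = U_s, `SamePDropOfSkeletonFrmFrom₁` = U, the planners' end state): no node, no statement, no `@[conjecture]`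
is declared here.  Lane `prim-bschramm`, seat `prim-bschramm-p3` gen 25 (N2 design owner; P3-NILPOTENT §18.3 (α) / §18.4 (D-s2), authorised by RULING D-s (c));
helper file (`--supports stmt-CriticalPhenomena-4575 --as helper`); PROOFS ONLY (def-free: the residue types are packaged existentially).

WHAT IT RECORDS (the 'no statement-level shortcut' analysis of §18.3 made kernel facts, for the planners' sizing of the rung above N2).  Let
`Φ : PlanarSkeletonFrmScaled G` (p4-g16: an `L`-Lipschitz chart `φ : V → ℤ²`, translating frames, EXACT single-edge steps of length `N`, one or more types)
and let `Φ.coarse v = (φ v) / N` (componentwise Euclidean quotient, p4-g16).  Then: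
* §1 integer arithmetic of the Euclidean quotient: `|a − b| ≤ N ℓ ⟹ |a/N − b/N| ≤ ℓ` and `|a/N − b/N| ≤ ℓ ⟹ |a − b| ≤ N(ℓ+1) − 1`;
* §2 **`coarse_lip`: if `L ≤ N` the coarse chart is 1-LIPSCHITZ along edges** (`Skelφ.Lip G Φ.coarse`) — together with p4's `steps_coarse` (`Skelφ.Steps G Φ.coarse`:
  the `N`-steps are single-edge UNIT steps of the coarse chart) these are two of the four structural hypotheses LEVEL 0 of the N2 closure consumes; the fine/coarse
  CYLINDER SANDWICH `cyl φ t (Nℓ) ⊆ cyl ⌊φ/N⌋ t ℓ ⊆ cyl φ t (N(ℓ+1) − 1)`;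
* §3 **frames**: an automorphism translating the fine chart by a vector `c` with `N ∣ c` translates the coarse chart EXACTLY by `c/N` (`coarse_translate_of_dvd`); for a
  ONE-TYPE `Φ` any two vertices are exchanged by a fine-chart-translating automorphism (`exists_fineFrame`), and **`exists_coarseTypes`: there is a finite set `T ∋ t` of at
  most `N²` base vertices (one per residue of `φ − φ t (mod N)`) such that `Skelφ.Frames G Φ.coarse T`** — every vertex is the image of a member of `T` under an automorphism
  translating the COARSE chart exactly — **and the types in `T` are HOMOGENEOUS**: pairwise exchanged by automorphisms translating the FINE chart.
So the coarse chart of a one-type scaled skeleton with `L ≤ N` (every `CayleyScaled` customer has `L = N`) carries `Skelφ.Lip`, `Skelφ.Steps` and `Skelφ.Frames` with `≤ N²`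
homogeneous types: what separates U_s from the CLOSED one-type node N2 at the level of LEVEL 0's dictionary is exactly (multi-type, homogeneous) + (κ′) — P3-NILPOTENT §18.
[cite: KozmaNitzan2024, §4 p. 15 (boxes and their translates), p. 16 (Lemma 8: the role of the lattice symmetries)] [cite: BenjaminiSchramm1996, Conj. 4; §2]
[cite: MartineauTassion2017, §3.2]
-/

noncomputable section

namespace Summit.CriticalPhenomena.PercolationContinuityZ3.Theorems.Transplant

open Literature.Probability.LatticeModels SimpleGraph
open scoped Classical

namespace PlanarSkeletonFrmScaled

/-! ## §1 Integer arithmetic of the Euclidean quotient -/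

/-- `a − b ≤ N ℓ ⟹ a/N − b/N ≤ ℓ` (`N > 0`, Euclidean quotient). [folklore] -/
theorem ediv_sub_ediv_le {a b N ℓ : ℤ} (hN : 0 < N) (h : a - b ≤ N * ℓ) : a / N - b / N ≤ ℓ := by
  have h1 : a / N ≤ (b + ℓ * N) / N := Int.ediv_le_ediv hN (by linarith)
  rw [Int.add_mul_ediv_right _ _ hN.ne'] at h1
  linarith

/-- **`|a − b| ≤ N ℓ ⟹ |a/N − b/N| ≤ ℓ`** (`N > 0`). [folklore] -/
theorem abs_ediv_sub_ediv_le {a b N ℓ : ℤ} (hN : 0 < N) (h : |a - b| ≤ N * ℓ) : |a / N - b / N| ≤ ℓ := by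
  rw [abs_le] at h ⊢
  refine ⟨?_, ediv_sub_ediv_le hN h.2⟩
  have := ediv_sub_ediv_le (a := b) (b := a) (ℓ := ℓ) hN (by linarith)
  linarith

/-- **`|a/N − b/N| ≤ ℓ ⟹ |a − b| ≤ N (ℓ + 1) − 1`** (`N > 0`; the remainders differ by at most `N − 1`). [folklore] -/
theorem abs_sub_le_of_abs_ediv_sub_ediv_le {a b N ℓ : ℤ} (hN : 0 < N) (h : |a / N - b / N| ≤ ℓ) : |a - b| ≤ N * (ℓ + 1) - 1 := by
  have ha := Int.mul_ediv_add_emod a N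
  have hb := Int.mul_ediv_add_emod b N
  have ha0 := Int.emod_nonneg a hN.ne'
  have hb0 := Int.emod_nonneg b hN.ne'
  have ha1 := Int.emod_lt_of_pos a hN
  have hb1 := Int.emod_lt_of_pos b hN
  rw [abs_le] at h ⊢
  have hup : N * (a / N - b / N) ≤ N * ℓ := mul_le_mul_of_nonneg_left h.2 hN.le
  have hlo : N * -ℓ ≤ N * (a / N - b / N) := mul_le_mul_of_nonneg_left h.1 hN.le
  constructor <;> nlinarith

/-! ## §2 The coarse chart: Lipschitz constant one when `L ≤ N`; the cylinder sandwich -/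

variable {V : Type} {G : SimpleGraph V} [G.LocallyFinite] (Φ : PlanarSkeletonFrmScaled G)

/-- The step length is a positive integer. [folklore] -/
theorem N_pos : 0 < (Φ.N : ℤ) := by have := Φ.one_le_N; omega

/-- The coarse chart, coordinatewise. [folklore] -/
theorem coarse_apply (v : V) (i : Fin 2) : Φ.coarse v i = Φ.φ v i / (Φ.N : ℤ) := rfl

/-- **THE COARSE CHART IS 1-LIPSCHITZ WHEN `L ≤ N`**: `|φ u − φ v| ≤ L ≤ N` along an edge forces `|⌊φ u/N⌋ − ⌊φ v/N⌋| ≤ 1` — the dictionary entry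
`Skelφ.Lip` that LEVEL 0 of the N2 closure consumes, for the coarse chart. (Every `CayleyScaled` customer has `L = N`.) [cite: KozmaNitzan2024, §4 p. 16 (Lemma 8)] -/
theorem coarse_lip (hLN : Φ.L ≤ Φ.N) : Skelφ.Lip G Φ.coarse := by
  intro u v huv i
  rw [coarse_apply, coarse_apply]
  refine abs_ediv_sub_ediv_le Φ.N_pos ?_
  rw [mul_one]
  exact (Φ.lip huv i).trans (by exact_mod_cast hLN)

/-- Fine displacements of size `≤ N ℓ` are coarse displacements of size `≤ ℓ`. [folklore] -/
theorem abs_coarse_sub_le {v w : V} {i : Fin 2} {ℓ : ℕ} (h : |Φ.φ v i - Φ.φ w i| ≤ (Φ.N : ℤ) * ℓ) : |Φ.coarse v i - Φ.coarse w i| ≤ ℓ :=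
  abs_ediv_sub_ediv_le Φ.N_pos h

/-- Coarse displacements of size `≤ ℓ` are fine displacements of size `≤ N(ℓ+1) − 1`. [folklore] -/
theorem abs_sub_le_of_coarse {v w : V} {i : Fin 2} {ℓ : ℕ} (h : |Φ.coarse v i - Φ.coarse w i| ≤ ℓ) :
    |Φ.φ v i - Φ.φ w i| ≤ (Φ.N : ℤ) * (ℓ + 1) - 1 :=
  abs_sub_le_of_abs_ediv_sub_ediv_le Φ.N_pos h

/-- **CYLINDER SANDWICH, inner half**: the fine cylinder of half-width `N ℓ` lies in the coarse cylinder of half-width `ℓ`.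
[cite: KozmaNitzan2024, §4 p. 15 (boxes and their translates)] -/
theorem cyl_fine_subset_coarse (t : V) (ℓ : ℕ) : Skelφ.cyl Φ.φ t (Φ.N * ℓ) ⊆ Skelφ.cyl Φ.coarse t ℓ := by
  intro w hw
  rw [Skelφ.mem_cyl, mem_box] at hw ⊢
  intro i
  have h := hw i
  rw [Pi.sub_apply] at h ⊢
  have h' : |Φ.φ w i - Φ.φ t i| ≤ (Φ.N : ℤ) * ℓ := by rw [abs_le]; exact_mod_cast h
  exact abs_le.1 (Φ.abs_coarse_sub_le h')

/-- **CYLINDER SANDWICH, outer half**: the coarse cylinder of half-width `ℓ` lies in the fine cylinder of half-width `N(ℓ+1) − 1`.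
[cite: KozmaNitzan2024, §4 p. 15 (boxes and their translates)] -/
theorem cyl_coarse_subset_fine (t : V) (ℓ : ℕ) : Skelφ.cyl Φ.coarse t ℓ ⊆ Skelφ.cyl Φ.φ t (Φ.N * (ℓ + 1) - 1) := by
  intro w hw
  rw [Skelφ.mem_cyl, mem_box] at hw ⊢
  intro i
  have h := hw i
  rw [Pi.sub_apply] at h ⊢
  have h' : |Φ.coarse w i - Φ.coarse t i| ≤ ℓ := abs_le.2 h
  have key := Φ.abs_sub_le_of_coarse h'
  have hN1 : 1 ≤ Φ.N * (ℓ + 1) := le_trans Φ.one_le_N (Nat.le_mul_of_pos_right _ (Nat.succ_pos ℓ))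
  have hcast : ((Φ.N * (ℓ + 1) - 1 : ℕ) : ℤ) = (Φ.N : ℤ) * (ℓ + 1) - 1 := by
    rw [Nat.cast_sub hN1]; push_cast; ring
  rw [hcast]
  exact abs_le.1 key

/-! ## §3 Frames of the coarse chart: exact coarse translations from `N`-divisible fine translations; residue types; homogeneity -/

/-- **An automorphism translating the FINE chart by an `N`-divisible vector translates the COARSE chart EXACTLY** (by `c/N`): `⌊(a + N d)/N⌋ = ⌊a/N⌋ + d`.
[cite: KozmaNitzan2024, §4 p. 16 (Lemma 8)] -/
theorem coarse_translate_of_dvd {α : G ≃g G} {c : Site 2} (hα : ∀ w, Φ.φ (α w) = Φ.φ w + c) (hc : ∀ i, (Φ.N : ℤ) ∣ c i) (w : V) :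
    Φ.coarse (α w) = Φ.coarse w + fun i => c i / (Φ.N : ℤ) := by
  funext i
  obtain ⟨d, hd⟩ := hc i
  rw [Pi.add_apply, coarse_apply, coarse_apply, hα w, Pi.add_apply, hd, mul_comm, Int.add_mul_ediv_right _ _ Φ.N_pos.ne',
    Int.mul_ediv_cancel _ Φ.N_pos.ne']

/-- **Homogeneity of a ONE-TYPE skeleton**: any two vertices `u, v` are exchanged by an automorphism translating the fine chart by `φ v − φ u` (compose the frame of
`v` with the inverse frame of `u`). [cite: KozmaNitzan2024, §4 p. 15 (boxes and their translates)] -/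
theorem exists_fineFrame {t : V} (h1 : Φ.types = {t}) (u v : V) : ∃ β : G ≃g G, β u = v ∧ ∀ w, Φ.φ (β w) = Φ.φ w + (Φ.φ v - Φ.φ u) := by
  obtain ⟨tu, htu, γ, hγt, hγ⟩ := Φ.frame u
  obtain ⟨tv, htv, α, hαt, hα⟩ := Φ.frame v
  rw [h1, Finset.mem_singleton] at htu htv
  rw [htu] at hγt hγ
  rw [htv] at hαt hα
  refine ⟨γ.symm.trans α, ?_, fun w => ?_⟩
  · show α (γ.symm u) = v
    rw [← hγt, γ.symm_apply_apply, hαt]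
  · show Φ.φ (α (γ.symm w)) = Φ.φ w + (Φ.φ v - Φ.φ u)
    have hw : Φ.φ w = Φ.φ (γ.symm w) + (Φ.φ u - Φ.φ t) := by rw [← hγ (γ.symm w), γ.apply_symm_apply]
    rw [hα, hw]; abel

/-- **THE COARSE TYPES (existential packaging, def-free).**  For a ONE-TYPE scaled skeleton there is a finite set `T` of base vertices with `t ∈ T`, `|T| ≤ N²` (one vertex per
residue class of `φ − φ t (mod N)` that occurs), such that (i) **`Skelφ.Frames G Φ.coarse T`**: every vertex `v` is the image of some `t' ∈ T` under an automorphism translating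
the COARSE chart EXACTLY by `⌊φ v/N⌋ − ⌊φ t'/N⌋` — namely the composite frame `t' ↦ t ↦ v`, whose fine translation `φ v − φ t'` is `N`-divisible —, and (ii) the types are
HOMOGENEOUS: any two members of `T` are exchanged by an automorphism translating the FINE chart.  (Multi-type is forced: a fine frame by `c` translates `⌊φ/N⌋` only when
`N ∣ c`.) [cite: KozmaNitzan2024, §4 p. 16 (Lemma 8: the role of the lattice symmetries)] -/
theorem exists_coarseTypes {t : V} (h1 : Φ.types = {t}) :
    ∃ T : Finset V, t ∈ T ∧ T.card ≤ Φ.N ^ 2 ∧ Skelφ.Frames G Φ.coarse T ∧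
      ∀ t₁ ∈ T, ∀ t₂ ∈ T, ∃ β : G ≃g G, β t₁ = t₂ ∧ ∀ w, Φ.φ (β w) = Φ.φ w + (Φ.φ t₂ - Φ.φ t₁) := by
  have hN := Φ.N_pos
  -- residues of the fine translation `φ v − φ t` modulo `N`; one representative per residue, `t` representing its own
  let res : V → (Fin 2 → ℤ) := fun v i => (Φ.φ v i - Φ.φ t i) % (Φ.N : ℤ)
  let rep : (Fin 2 → ℤ) → V := fun ρ => if ρ = res t then t else if h : ∃ v, res v = ρ then h.choose else t
  let R : Finset (Fin 2 → ℤ) := Fintype.piFinset fun _ : Fin 2 => Finset.Ico (0 : ℤ) Φ.N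
  have hres_mem : ∀ v, res v ∈ R := fun v => by
    rw [Fintype.mem_piFinset]
    intro i
    rw [Finset.mem_Ico]
    exact ⟨Int.emod_nonneg _ hN.ne', Int.emod_lt_of_pos _ hN⟩
  have hrep_t : rep (res t) = t := by simp [rep]
  have hrep : ∀ v, res (rep (res v)) = res v := fun v => by
    by_cases hv : res v = res t
    · rw [hv, hrep_t]
    · have h : ∃ v', res v' = res v := ⟨v, rfl⟩
      simp only [rep, if_neg hv, dif_pos h]
      exact h.choose_spec
  have hcardR : R.card = Φ.N ^ 2 := by
    rw [Fintype.card_piFinset, Finset.prod_const, Finset.card_univ, Fintype.card_fin, Int.card_Ico, sub_zero, Int.toNat_natCast]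
  refine ⟨R.image rep, ?_, (Finset.card_image_le).trans hcardR.le, fun v => ?_, fun t₁ _ t₂ _ => Φ.exists_fineFrame h1 t₁ t₂⟩
  · rw [← hrep_t]; exact Finset.mem_image_of_mem rep (hres_mem t)
  · -- the frame of `v` from its residue representative `t'`: fine translation `φ v − φ t'` is `N`-divisible, so the coarse chart is translated exactly
    set t' : V := rep (res v) with ht'
    obtain ⟨β, hβt, hβ⟩ := Φ.exists_fineFrame h1 t' v
    have hdvd : ∀ i, (Φ.N : ℤ) ∣ (Φ.φ v - Φ.φ t') i := by
      intro i
      have h : res t' i = res v i := by rw [ht', hrep v]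
      have hmod : Int.ModEq (Φ.N : ℤ) (Φ.φ t' i - Φ.φ t i) (Φ.φ v i - Φ.φ t i) := h
      have := hmod.dvd
      rwa [sub_sub_sub_cancel_right] at this
    refine ⟨t', Finset.mem_image_of_mem rep (hres_mem v), β, hβt, fun w => ?_⟩
    rw [Φ.coarse_translate_of_dvd hβ hdvd w]
    congr 1
    funext i
    obtain ⟨d, hd⟩ := hdvd i
    rw [Pi.sub_apply] at hd
    have hv : Φ.φ v i = Φ.φ t' i + d * (Φ.N : ℤ) := by linarith
    rw [Pi.sub_apply, Pi.sub_apply, hd, Int.mul_ediv_cancel_left _ hN.ne', coarse_apply, coarse_apply, hv, Int.add_mul_ediv_right _ _ hN.ne']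
    ring

/-- **SUMMARY — what the coarse chart of a one-type scaled skeleton with `L ≤ N` carries**: `Skelφ.Lip` (1-Lipschitz), `Skelφ.Steps` (single-edge unit steps, p4-g16's
`steps_coarse`) and `Skelφ.Frames` over at most `N²` homogeneous types containing the base vertex.  These are three of the four structural entries of the φ-level
dictionary (SkelPhiCylBall §0) on which LEVEL 0 of the N2 closure runs; the fourth, (κ), becomes (κ′) through the cylinder sandwich of §2.  No node is applied or claimed.
[cite: KozmaNitzan2024, §4 p. 16 (Lemma 8)] [cite: MartineauTassion2017, §3.2] -/
theorem coarse_dictionary {t : V} (h1 : Φ.types = {t}) (hLN : Φ.L ≤ Φ.N) :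
    Skelφ.Lip G Φ.coarse ∧ Skelφ.Steps G Φ.coarse ∧
      ∃ T : Finset V, t ∈ T ∧ T.card ≤ Φ.N ^ 2 ∧ Skelφ.Frames G Φ.coarse T ∧
        ∀ t₁ ∈ T, ∀ t₂ ∈ T, ∃ β : G ≃g G, β t₁ = t₂ ∧ ∀ w, Φ.φ (β w) = Φ.φ w + (Φ.φ t₂ - Φ.φ t₁) :=
  ⟨Φ.coarse_lip hLN, Φ.steps_coarse, Φ.exists_coarseTypes h1⟩

end PlanarSkeletonFrmScaled

end Summit.CriticalPhenomena.PercolationContinuityZ3.Theorems.Transplant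

end
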